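import Summits.Ventures.GridStability.Lyapunov.GroundedLaplacianConnectivity
import Literature.Computation.Certificates.CliqueSumBlockLDL
import HarnessLib

/-!
# Grounded-Laplacian connectivity certificates through the SPARSE clique-sum lane (T-L2b glue)

Venture GRIDFUSION, G2-SCALE cell, lead g19 D13 «T-L2b» (owner gridfusion-sos-5 g9). T-L2
(`GroundedLaplacianConnectivity.lean`) reduced the variational connectivity certificate
`∀ z, λ·pairNormSq z ≤ (m+1)·½ΣΣ aᵢⱼ(zᵢ − zⱼ)²` to `Matrix.PosSemidef (groundedLaplacian a g λ)`, an `m × m`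
matrix with the SPARSITY OF THE GRAPH. This file lets that PSD fact come from the tree's row-streamed
clique-sum lane (`Literature/Computation/Certificates/CliqueSumSparseCheck.lean` + `CliqueSumBlockLDL.lean`,
lit-5 / sos-4; certnum I4478: no other sparse-pattern PSD lane exists): the certificate is a list of sparse
target rows (`SRow ℚ`, `≈ nnz(L_g)` literals) and a list of small clique blocks `Σ_c P_cᵀ S_c P_c` (for a graph
eliminated in a perfect / clique-tree order the exact `LDLᵀ` has NO fill, so `L_g − λI = Σ_i d_i ℓ_i ℓ_iᵀ` with
`supp ℓ_i ⊆ {i} ∪` later neighbours: `N − 1` blocks of size `w + 1`, `w = 1` on a radial feeder), checked by ONE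
`cliqueSweepS … = true` decide (cost `≈ Σ k_c² + N`) and one `ldlAll` decide (in-kernel exact `LDLᵀ` of every block).
The only instance-specific obligation left is the ℚ-matrix identity `matrixOfSparseRows m m rows =
groundedLaplacianQ aQ g λ` (definitional data vs. the typed weights), decided in the kernel per instance.

THREE COLUMNS. CERTIFIED (kernel): `groundedLaplacian_ratCast` (the real grounded matrix of rational weights is
the cast of the rational one), `connectivity_certificate_of_grounded_sparseCert` (sparse rows + clique blocks +
the two decides + the row identity ⇒ the variational connectivity certificate). VALIDATED / MODELLED: nothing.
[cite: ZhengFantuzziPapachristodoulou2018, §3.2 Theorem 2 («if» direction) — the clique-sum PSD criterion the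
lane implements; DorflerBullo2013, arXiv:1102.2950 §2.6 (grounded Laplacian)]
-/

namespace Summit.Ventures.GridStability.Lyapunov

open Finset Matrix
open Literature.MathematicalPhysics.PowerSystems
open Literature.Computation.Certificates Literature.Computation.Certificates.PSD

variable {m : ℕ}

/-- The grounded shifted Laplacian over `ℚ` (same formula as `groundedLaplacian`, rational weights) — the
computable side of the per-instance row identity. [cite: DorflerBullo2013, arXiv:1102.2950 §2.6] -/
def groundedLaplacianQ (aQ : Fin (m + 1) → Fin (m + 1) → ℚ) (g : Fin (m + 1)) (lam : ℚ) :
    Matrix (Fin m) (Fin m) ℚ :=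
  Matrix.of fun i j =>
    (if i = j then (∑ k, aQ (g.succAbove i) k) - lam else 0) - aQ (g.succAbove i) (g.succAbove j)

/-- Casting commutes with the grounded-Laplacian formula: for rational weights `aQ`,
`groundedLaplacian (↑aQ) g ↑λ = (groundedLaplacianQ aQ g λ).map (↑)`. [folklore] -/
theorem groundedLaplacian_ratCast (aQ : Fin (m + 1) → Fin (m + 1) → ℚ) (g : Fin (m + 1)) (lam : ℚ) :
    groundedLaplacian (fun i j => (aQ i j : ℝ)) g (lam : ℝ)
      = (groundedLaplacianQ aQ g lam).map (Rat.cast : ℚ → ℝ) := by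
  ext i j
  simp only [groundedLaplacian, groundedLaplacianQ, Matrix.map_apply, Matrix.of_apply]
  split_ifs <;> push_cast <;> ring

/-- **T-L2b: the variational connectivity certificate from a SPARSE clique-sum certificate of the grounded
Laplacian.** Data: rational symmetric weights `aQ`, a grounded node `g`, `λ ≥ 0`, the sparse target rows `rows`
(`≈ nnz` literals) and clique blocks `bs` (for a no-fill elimination order: `N − 1` rank-one `(w+1) × (w+1)`
blocks). Kernel obligations: `hrows` (the rows ARE `L_g − λI`, one decide over `ℚ`), `hsweep` (row-streamed
clique-sum identity, `cliqueSweepS`), `hldl` (every block PSD by in-kernel exact `LDLᵀ`, `ldlAll`). Conclusion =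
the hypothesis `hlam` of the dVOC Condition-2 / droop / Kuramoto chains for the real weights `↑aQ`.
[cite: ZhengFantuzziPapachristodoulou2018, §3.2 Theorem 2 («if» direction); DorflerBullo2012, arXiv:0910.5673 §5.2 Lemma 5.9] -/
theorem connectivity_certificate_of_grounded_sparseCert (aQ : Fin (m + 1) → Fin (m + 1) → ℚ)
    (ha : ∀ i j, aQ i j = aQ j i) (g : Fin (m + 1)) (lam : ℚ) (hlam : 0 ≤ lam)
    (rows : List (SRow ℚ)) (bs : List (Block m ℚ))
    (hrows : matrixOfSparseRows m m rows = groundedLaplacianQ aQ g lam)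
    (hsweep : cliqueSweepS m 0 m rows bs = true) (hldl : ldlAll bs = true) :
    ∀ z : Fin (m + 1) → ℝ,
      (lam : ℝ) * pairNormSq z
        ≤ ((m + 1 : ℕ) : ℝ) * (1 / 2 * ∑ i, ∑ j, (aQ i j : ℝ) * (z i - z j) ^ 2) := by
  have hpsd : ((matrixOfSparseRows m m rows).map (Rat.cast : ℚ → ℝ)).PosSemidef :=
    posSemidef_map_of_cliqueSweepS_ldl hsweep hldl
  rw [hrows, ← groundedLaplacian_ratCast] at hpsd
  exact connectivity_certificate_of_grounded_posSemidef (fun i j => (aQ i j : ℝ))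
    (fun i j => by exact_mod_cast ha i j) g (lam : ℝ) (by exact_mod_cast hlam) hpsd

end Summit.Ventures.GridStability.Lyapunov
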